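import Literature.NumberTheory.Automorphic.Liu2021.AppendixC.AlbaneseTraceOfNablaDescent
import Literature.AlgebraicGeometry.Motives.Jacobian
import HarnessLib

/-!
# Liu 2021 App. C / §2.1: the cocycle identity `α_X(a,b) · α_X(b,c) = α_X(a,c)` of an Albanese morphism and the
# vanishing of stabiliser sums `∏_γ α_X(γx, γsx) = 0`

[Liu2021] = Yifeng Liu, *Fourier–Jacobi cycles and arithmetic relative trace formula*, Camb. J. Math. **9** (2021)
= arXiv:2102.11518 (v2 numbering; `l. NNNN` = lines of the author's `FJcycle.tex`, as in `AppendixC/Glue.lean`).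
Def. 2.3 (l. 1202–1206) types the Albanese datum `(∇X, Alb_X, α_X)` of a proper smooth `k`-scheme by corepresentability
ALONE (`AppendixC.Albanese`: `diag_α`, `desc`/`fac`/`uniq`).  In Serre's / Milne's construction of the corepresenting
object (Liu l. 1194–1200: «By Serre's construction [Ser59] of the Albanese variety»; Milne, *Jacobian Varieties* §6,
the map `F(x, y) = f^P(x) − f^P(y)`), the Albanese morphism is a DIFFERENCE map and therefore satisfies the cocycle
identity `α(a,b) · α(b,c) = α(a,c)` on composable pairs — the identity Lang uses implicitly when he writes the trace
`h_*(y) = Σ_g f(g x)` of a finite Galois quotient with ONE base point ([Lang1983AbelianVarieties] Ch. VIII §6, proof of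
Thm. 13, pp. 224–227).  This PROOF FILE (theorems and one `Prop`-valued predicate family; no named fact, no instance,
sorry-free) isolates that identity for the ABSTRACT datum and derives its formal consequences, as piece P3 of the
discharge of the named fact `AlbaneseTraceOfFiniteQuotient` (`AppendixC/AlbaneseFiniteQuotientTrace.lean`) along the
`∇`-descent reformulation `AppendixC/AlbaneseTraceOfNablaDescent.lean`:

* `Nabla.IsCocycle N β` — for a carrier `∇X` (Def. 2.1 (1)) and a morphism `β : ∇X → B` to an abelian variety: the
  cocycle identity in Yoneda form, «for all `T`-points `(a,b), (b,c), (a,c)` of `∇X`, `β(a,b) · β(b,c) = β(a,c)`» (points of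
  `B` multiplied in Mathlib's group `Hom_k(T, B)`); `Albanese.IsCocycle aX := aX.nabla.IsCocycle aX.α`.
* `Nabla.IsTransitive N` — «`(a,b), (b,c) ∈ ∇X ⇒ (a,c) ∈ ∇X`» in Yoneda form (the INTERFACE to piece P2, `∇` of a
  quotient; symmetry `Nabla.IsCocycle.swap` is formal, transitivity is not).
* formal calculus: `Nabla.IsCocycle.comp_eq_one` / `.diag_comp` (`β(a,a) = 1`), `.swap` (`β(b,a) = β(a,b)⁻¹`), `.comp_hom`, `.comp_map`,
  `.finsetProd`; `Motives.Jacobian.isCocycle` (Milne's point-free datum IS a cocycle, by its axiom `diff_cocycle`).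
* TRANSPORT `Albanese.IsCocycle.of_albanese`: any two Albanese data of `X` are cocycles together (uniqueness of `∇X` and of
  `Alb_X` up to isomorphism, `AlbaneseFunctorial`); `Albanese.IsCocycle.isCocycle_of_diag_comp`: once `α_X` is a cocycle,
  EVERY diagonal-killing morphism from any carrier `∇X` to any abelian variety is one (it factors through `α_X`).
* STABILISER SUMS VANISH `Albanese.IsCocycle.prod_map_comp_α_eq_one`: for `act : Δ →* Aut X` (`Δ` finite), `s ∈ Δ` and a
  `T`-point `(x, s·x)` of `∇X`, `∏_{γ ∈ Δ} α_X(γ·x, γs·x) = 1` — by telescoping the cocycle along the chains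
  `c·x, cs·x, …, cs^m·x = c·x` over the left cosets `c⟨s⟩` (NO base point, no model); and the `(T♭)`-shaped corollary
  `Albanese.IsCocycle.comp_α_comp_sum_map_eq_one`: the `∇`-morphism `α_X ≫ Σ_g Alb_{act g}` of
  `AlbaneseTraceOfNablaDescent` kills every such point — the well-definedness step of Lang's `h_*`.

What is NOT claimed: that an abstract `Albanese X` IS a cocycle (piece P3b: true for the tree's MODEL — split schemes with
Milne data of the pieces, and by Galois descent for smooth projective `X` over `k ⊂ ℂ` — in a separate file), transitivity
of `∇X` (piece P2), flatness / effective descent along `∇p` (piece P1), and the named fact (T) itself.  HC_CM is NOT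
proved here; nothing in this file discharges a COR-CM binder.  Cell hodgecm-mathlib (D-0151), row VI-5, piece P3a; ours
(formalisation glue), axioms `propext`, `Classical.choice`, `Quot.sound`.

## References
* [Liu2021] Y. Liu, arXiv:2102.11518 = Camb. J. Math. 9 (2021), §2.1 Def. 2.1 (1) (l. 1171–1176), Proposition
  (l. 1190–1200), Def. 2.3 (l. 1202–1208).
* [Lang1983AbelianVarieties] S. Lang, *Abelian Varieties* (Springer 1983 reprint), Ch. VIII §6 Thm. 13 and its proof
  (pp. 224–227: the homomorphism `h_*`).
* [Milne1986JacobianVarieties] J. S. Milne, *Jacobian Varieties* (1986), §6 Prop. 6.4, Remark 6.5.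
-/

noncomputable section

open CategoryTheory AlgebraicGeometry MonoidalCategory CartesianMonoidalCategory
open Literature.AlgebraicGeometry.Motives (SchemeOver AbelianVariety Jacobian)

namespace Literature.NumberTheory.Automorphic.Liu2021.AppendixC

universe u

open scoped MonObj

variable {k : Type u} [Field k] {X Y : SchemeOver k}

/-! ## The cocycle identity and transitivity, in Yoneda form -/

namespace Nabla

/-- **The cocycle identity `β(a,b) · β(b,c) = β(a,c)`** for a morphism `β : ∇X → B` from a carrier `∇X ↪ X × X`
(Def. 2.1 (1)) to an abelian variety `B`, in Yoneda form: for every `k`-scheme `T` and all `T`-points `ab, bc, ac` of `∇X`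
lying over `(a,b), (b,c), (a,c) : T → X × X`, the `T`-points `β(a,b)`, `β(b,c)`, `β(a,c)` of `B` satisfy
`β(a,b) · β(b,c) = β(a,c)` in Mathlib's group `Hom_k(T, B)`.  This is the identity satisfied by a difference map
`(x, y) ↦ f(x) − f(y)` (Milne §6; Liu l. 1194–1200 «Serre's construction»); stated so that neither the triple fibre product
nor the transitivity of `∇X` is needed to FORMULATE it.  Ours. [cite: Liu2021, §2.1 Def. 2.1 (1) (l. 1171–1176) and proof of the Proposition (l. 1194–1200)]
[cite: Milne1986JacobianVarieties, §6 Prop. 6.4, Remark 6.5] -/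
def IsCocycle (N : Nabla X) {B : AbelianVariety k} (β : N.N ⟶ B.X) : Prop :=
  ∀ ⦃T : SchemeOver k⦄ (a b c : T ⟶ X) (ab bc ac : T ⟶ N.N),
    ab ≫ N.incl = lift a b → bc ≫ N.incl = lift b c → ac ≫ N.incl = lift a c →
      (ab ≫ β) * (bc ≫ β) = ac ≫ β

/-- **Transitivity of `∇X`** in Yoneda form: `T`-points `(a,b)` and `(b,c)` of `∇X` give a `T`-point `(a,c)` of `∇X`.
(Geometrically `∇X_{k̄} = ⊔ᵢ Xᵢ × Xᵢ` over the connected components `Xᵢ`, an equivalence relation; symmetry is formal from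
the minimality of Def. 2.1 (1), transitivity is NOT — it is the interface to the «`∇` of a quotient» piece.)  Ours.
[cite: Liu2021, §2.1 Def. 2.1 (1) (l. 1171–1176) and proof of the Proposition (l. 1194–1200)] -/
def IsTransitive (N : Nabla X) : Prop :=
  ∀ ⦃T : SchemeOver k⦄ (a b c : T ⟶ X) (ab bc : T ⟶ N.N),
    ab ≫ N.incl = lift a b → bc ≫ N.incl = lift b c → ∃ ac : T ⟶ N.N, ac ≫ N.incl = lift a c

variable {N : Nabla X} {B B' : AbelianVariety k} {β : N.N ⟶ B.X}

/-- A `T`-point of `∇X` over `(a, a)` is `a ≫ ΔX` (the inclusion `∇X ↪ X × X` is a monomorphism). Ours.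
[cite: Liu2021, §2.1 Def. 2.1 (1) (l. 1171–1176)] -/
theorem eq_comp_diag_of_incl {T : SchemeOver k} (a : T ⟶ X) (aa : T ⟶ N.N) (h : aa ≫ N.incl = lift a a) :
    aa = a ≫ N.diag := by
  rw [← cancel_mono N.incl, h, Category.assoc, N.diag_incl, comp_lift, Category.comp_id]

/-- A cocycle kills the points over the diagonal: `β(a,a) = 1`, hence `ΔX ≫ β = 1` (cocycle identity at `(a,a,a)`).
Ours. [cite: Milne1986JacobianVarieties, §6 (before Prop. 6.4)] -/
theorem IsCocycle.comp_eq_one (hβ : N.IsCocycle β) {T : SchemeOver k} (a : T ⟶ X) (aa : T ⟶ N.N)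
    (h : aa ≫ N.incl = lift a a) : aa ≫ β = 1 :=
  mul_eq_left.mp (hβ a a a aa aa aa h h h)

/-- `ΔX ≫ β = 1` for a cocycle `β`. Ours. [cite: Milne1986JacobianVarieties, §6 (before Prop. 6.4)] -/
theorem IsCocycle.diag_comp (hβ : N.IsCocycle β) : N.diag ≫ β = 1 :=
  hβ.comp_eq_one (𝟙 X) N.diag N.diag_incl

/-- Antisymmetry of a cocycle: `β(b,a) = β(a,b)⁻¹` (cocycle identity at `(a,b,a)`). Ours.
[cite: Milne1986JacobianVarieties, §6 (definition of F)] -/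
theorem IsCocycle.swap (hβ : N.IsCocycle β) {T : SchemeOver k} (a b : T ⟶ X) (ab ba : T ⟶ N.N)
    (hab : ab ≫ N.incl = lift a b) (hba : ba ≫ N.incl = lift b a) : ba ≫ β = (ab ≫ β)⁻¹ := by
  have h := hβ a b a ab ba (a ≫ N.diag) hab hba (by rw [Category.assoc, N.diag_incl, comp_lift, Category.comp_id])
  rw [Category.assoc, hβ.diag_comp, MonObj.comp_one] at h
  exact eq_inv_of_mul_eq_one_right h

/-- Cocycles are stable under post-composition with a homomorphism of abelian varieties. Ours.
[cite: Liu2021, §2.1 Def. 2.3 (l. 1202–1208)] -/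
theorem IsCocycle.comp_hom (hβ : N.IsCocycle β) (ψ : B ⟶ B') : N.IsCocycle (β ≫ ψ.hom.hom.hom) := by
  intro T a b c ab bc ac hab hbc hac
  rw [← Category.assoc, ← Category.assoc, ← Category.assoc, ← MonObj.mul_comp, hβ a b c ab bc ac hab hbc hac]

/-- Cocycles are stable under pre-composition with `∇u : ∇Y → ∇X` (Def. 2.1 (1): `∇u` is the restriction of `u × u`).
Ours. [cite: Liu2021, §2.1 Def. 2.1 (1) (l. 1174–1176)] -/
theorem IsCocycle.comp_map (hβ : N.IsCocycle β) (N' : Nabla Y) (u : Y ⟶ X) : N'.IsCocycle (N'.map N u ≫ β) := by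
  intro T a b c ab bc ac hab hbc hac
  simp only [← Category.assoc]
  exact hβ (a ≫ u) (b ≫ u) (c ≫ u) _ _ _
    (by rw [Category.assoc, N'.map_incl, ← Category.assoc, hab, lift_map])
    (by rw [Category.assoc, N'.map_incl, ← Category.assoc, hbc, lift_map])
    (by rw [Category.assoc, N'.map_incl, ← Category.assoc, hac, lift_map])

/-- A finite pointwise product of cocycles is a cocycle (the points of `B` form a COMMUTATIVE group). Ours.
[cite: Liu2021, §2.1 Def. 2.3 (l. 1202–1208)] -/
theorem IsCocycle.finsetProd {κ : Type*} (s : Finset κ) (β : κ → (N.N ⟶ B.X)) (hβ : ∀ i ∈ s, N.IsCocycle (β i)) :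
    N.IsCocycle (∏ i ∈ s, β i) := by
  classical
  induction s using Finset.induction_on with
  | empty =>
    intro T a b c ab bc ac _ _ _
    rw [Finset.prod_empty, MonObj.comp_one, MonObj.comp_one, MonObj.comp_one, mul_one]
  | insert i s hi ih =>
    intro T a b c ab bc ac hab hbc hac
    have h1 := hβ i (Finset.mem_insert_self i s) a b c ab bc ac hab hbc hac
    have h2 := ih (fun j hj => hβ j (Finset.mem_insert_of_mem hj)) a b c ab bc ac hab hbc hac
    rw [Finset.prod_insert hi, MonObj.comp_mul, MonObj.comp_mul, MonObj.comp_mul, ← h1, ← h2]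
    exact mul_mul_mul_comm _ _ _ _

/-- Transitivity transports along the comparison of two carriers `∇X` (both are «the smallest open and closed subscheme
of `X × X` containing the diagonal»). Ours. [cite: Liu2021, §2.1 Def. 2.1 (1) (l. 1171–1174)] -/
theorem IsTransitive.of_nabla {N N' : Nabla X} (hN : N.IsTransitive) : N'.IsTransitive := by
  intro T a b c ab bc hab hbc
  obtain ⟨ac, hac⟩ := hN a b c (ab ≫ N'.map N (𝟙 X)) (bc ≫ N'.map N (𝟙 X))
    (by rw [Category.assoc, N'.map_incl, ← Category.assoc, hab, lift_map, Category.comp_id, Category.comp_id])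
    (by rw [Category.assoc, N'.map_incl, ← Category.assoc, hbc, lift_map, Category.comp_id, Category.comp_id])
  exact ⟨ac ≫ N.map N' (𝟙 X), by
    rw [Category.assoc, N.map_incl, ← Category.assoc, hac, lift_map, Category.comp_id, Category.comp_id]⟩


/-- **Symmetry of `∇X`** (formal from minimality, Def. 2.1 (1)): the swap `σ(∇X) ↪ X × X` is open and closed and
contains the diagonal, so `∇X ⊆ σ(∇X)`; in Yoneda form, a `T`-point over `(a, b)` yields one over `(b, a)`. Ours.
[cite: Liu2021, §2.1 Def. 2.1 (1) (l. 1171–1174)] -/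
theorem exists_swap (N : Nabla X) {T : SchemeOver k} (a b : T ⟶ X) (ab : T ⟶ N.N) (hab : ab ≫ N.incl = lift a b) :
    ∃ ba : T ⟶ N.N, ba ≫ N.incl = lift b a := by
  haveI := N.isOpenImmersion_incl
  haveI := N.isClosedImmersion_incl
  haveI : IsIso (β_ X X).hom.left := (Over.forget _).map_isIso (β_ X X).hom
  obtain ⟨e, he⟩ := N.minimal N.N (N.incl ≫ (β_ X X).hom)
    (by rw [Over.comp_left]; infer_instance) (by rw [Over.comp_left]; infer_instance)
    ⟨N.diag, by rw [← Category.assoc, N.diag_incl, lift_braiding_hom]⟩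
  refine ⟨ab ≫ e, ?_⟩
  have he' : e ≫ N.incl = N.incl ≫ (β_ X X).inv := by
    rw [← cancel_mono (β_ X X).hom, Category.assoc, Category.assoc, Iso.inv_hom_id, Category.comp_id]
    exact he
  rw [Category.assoc, he', ← Category.assoc, hab, lift_braiding_inv]

end Nabla

/-- **Milne's point-free Albanese datum is a cocycle**: for `𝒥 : Motives.Jacobian C` (carrier `C × C`, difference map
`diff`, axiom `diff_cocycle`), the restriction `(∇C ↪ C × C) ≫ diff` of the difference map to ANY carrier `∇C` is a
cocycle.  Ours. [cite: Milne1986JacobianVarieties, §6 Prop. 6.4, Remark 6.5] -/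
theorem Nabla.isCocycle_of_jacobian {C : SchemeOver k} (N : Nabla C) (𝒥 : Jacobian C) :
    N.IsCocycle (N.incl ≫ 𝒥.diff) := by
  intro T a b c ab bc ac hab hbc hac
  have h := congrArg (fun g => lift a (lift b c) ≫ g) 𝒥.diff_cocycle
  simp only [MonObj.comp_mul, comp_lift_assoc, lift_fst, lift_snd_assoc, lift_snd] at h
  rw [← Category.assoc, ← Category.assoc, ← Category.assoc, hab, hbc, hac]
  exact h

namespace Albanese

/-- **The cocycle property of an Albanese datum** (Def. 2.3): its Albanese morphism `α_X : ∇X → Alb_X` satisfies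
`α(a,b) · α(b,c) = α(a,c)`.  NOT part of the corepresentability typing of `AppendixC.Albanese`; it holds for the
difference-map model (Serre/Milne) and transports to every datum (`IsCocycle.of_albanese`).  Ours.
[cite: Liu2021, §2.1 Def. 2.3 (l. 1202–1208) and proof of the Proposition (l. 1194–1200)] -/
abbrev IsCocycle (aX : Albanese X) : Prop :=
  aX.nabla.IsCocycle aX.α

variable (aX : Albanese X)

/-- The Albanese morphism of a second datum `aX'` is the one of `aX` up to the comparison of carriers `∇X` and the
comparison isomorphism `Alb_X ≅ Alb'_X`: `α' = ∇(𝟙) ≫ α ≫ Alb_{𝟙}` (functoriality `AlbaneseFunctorial` at `u = 𝟙 X`).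
Ours. [cite: Liu2021, §2.1 Def. 2.3 (l. 1202–1208)] -/
theorem α_eq_map_comp_α_comp (aX' : Albanese X) :
    aX'.α = aX'.nabla.map aX.nabla (𝟙 X) ≫ aX.α ≫ (aX.map aX' (𝟙 X)).hom.hom.hom := by
  have hc : ∀ (ψ : aX'.Alb ⟶ aX.Alb) (ψ' : aX.Alb ⟶ aX'.Alb),
      (ψ ≫ ψ').hom.hom.hom = ψ.hom.hom.hom ≫ ψ'.hom.hom.hom := fun _ _ => rfl
  rw [← aX'.α_map_assoc aX (𝟙 X), ← hc, ← Albanese.map_comp, Category.comp_id, Albanese.map_id]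
  exact (Category.comp_id _).symm

/-- **Transport**: if one Albanese datum of `X` is a cocycle, so is every other (`∇X` and `Alb_X` are unique up to
compatible isomorphism).  Ours. [cite: Liu2021, §2.1 Def. 2.3 (l. 1202–1208): «The abelian variety that corepresents the functor»] -/
theorem IsCocycle.of_albanese {aX : Albanese X} (h : aX.IsCocycle) (aX' : Albanese X) : aX'.IsCocycle := by
  change aX'.nabla.IsCocycle aX'.α
  rw [aX.α_eq_map_comp_α_comp aX', ← Category.assoc]
  exact (h.comp_map aX'.nabla (𝟙 X)).comp_hom _

/-- **Every diagonal-killing morphism to an abelian variety is a cocycle once `α_X` is**: for any carrier `N'` of `∇X`,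
any abelian variety `B` and `β : ∇X → B` with `ΔX ≫ β = 1`, `β` factors as `∇(𝟙) ≫ α_X ≫ ψ` with `ψ` the homomorphism of
the corepresentability (Def. 2.3), hence inherits the cocycle identity.  Ours. [cite: Liu2021, §2.1 Def. 2.3 (l. 1202–1208)] -/
theorem IsCocycle.isCocycle_of_diag_comp {aX : Albanese X} (h : aX.IsCocycle) (N' : Nabla X) {B : AbelianVariety k}
    (β : N'.N ⟶ B.X) (hβ : N'.diag ≫ β = 1) : N'.IsCocycle β := by
  -- transport `β` to the carrier of `aX` and factor it through `α_X`
  set β₀ : aX.nabla.N ⟶ B.X := aX.nabla.map N' (𝟙 X) ≫ β with hβ₀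
  have hβ₀1 : aX.nabla.diag ≫ β₀ = 1 := by
    rw [hβ₀, ← Category.assoc, Nabla.diag_map, Category.id_comp, hβ]
  have hfac : β = N'.map aX.nabla (𝟙 X) ≫ aX.α ≫ (aX.desc β₀ hβ₀1).hom.hom.hom := by
    rw [aX.fac β₀ hβ₀1, hβ₀, ← Category.assoc, ← Nabla.map_comp, Category.comp_id, Nabla.map_id, Category.id_comp]
  rw [hfac, ← Category.assoc]
  exact (h.comp_map N' (𝟙 X)).comp_hom _

/-! ## Stabiliser sums vanish -/

section Stabiliser

variable {aX} {Δ : Type*} [Group Δ] [Fintype Δ] (act : Δ →* Aut X)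

omit [Fintype Δ] in
/-- `(act (g * h)).hom = (act h).hom ≫ (act g).hom` (Mathlib's `Aut X` multiplies by `g * h = h ≪≫ g`). Ours. [folklore] -/
private theorem act_mul_hom (g h : Δ) : (act (g * h)).hom = (act h).hom ≫ (act g).hom := by
  rw [map_mul]; rfl

omit [Fintype Δ] in
/-- The `T`-point `∇(act g)(x, s·x) = (g·x, gs·x)` of `∇X` lies over `(x ≫ act g, x ≫ act (g * s))`. Ours.
[cite: Liu2021, §2.1 Def. 2.1 (1) (l. 1174–1176)] -/
private theorem map_point_incl (s g : Δ) {T : SchemeOver k} (x : T ⟶ X) (xs : T ⟶ aX.nabla.N)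
    (hxs : xs ≫ aX.nabla.incl = lift x (x ≫ (act s).hom)) :
    (xs ≫ aX.nabla.map aX.nabla (act g).hom) ≫ aX.nabla.incl =
      lift (x ≫ (act g).hom) (x ≫ (act (g * s)).hom) := by
  rw [Category.assoc, Nabla.map_incl, ← Category.assoc, hxs, lift_map, Category.assoc, ← act_mul_hom]

omit [Fintype Δ] in
/-- TELESCOPING along the chain `c·x, cs·x, cs²·x, …`: under transitivity of `∇X` and the cocycle identity,
`∏_{i < n} α(cs^i·x, cs^{i+1}·x) = α(c·x, cs^n·x)` for a suitable `T`-point of `∇X` over `(c·x, cs^n·x)`. Ours.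
[cite: Lang1983AbelianVarieties, Ch. VIII §6, proof of Thm. 13 (pp. 224–227)] -/
private theorem exists_chain (hN : aX.nabla.IsTransitive) (h : aX.IsCocycle) (s c : Δ) {T : SchemeOver k} (x : T ⟶ X)
    (xs : T ⟶ aX.nabla.N) (hxs : xs ≫ aX.nabla.incl = lift x (x ≫ (act s).hom)) (n : ℕ) :
    ∃ R : T ⟶ aX.nabla.N, R ≫ aX.nabla.incl = lift (x ≫ (act c).hom) (x ≫ (act (c * s ^ n)).hom) ∧
      ∏ i ∈ Finset.range n, (xs ≫ aX.nabla.map aX.nabla (act (c * s ^ i)).hom) ≫ aX.α = R ≫ aX.α := by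
  induction n with
  | zero =>
    refine ⟨(x ≫ (act c).hom) ≫ aX.nabla.diag, ?_, ?_⟩
    · rw [pow_zero, mul_one, Category.assoc, aX.nabla.diag_incl, comp_lift, Category.comp_id]
    · rw [Finset.range_zero, Finset.prod_empty, Category.assoc, aX.diag_α, MonObj.comp_one]
  | succ n ih =>
    obtain ⟨R, hR, hprod⟩ := ih
    have hQ := map_point_incl act s (c * s ^ n) x xs hxs
    rw [mul_assoc, ← pow_succ] at hQ
    obtain ⟨R', hR'⟩ := hN _ _ _ R _ hR hQ
    refine ⟨R', hR', ?_⟩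
    rw [Finset.prod_range_succ, hprod]
    exact h _ _ _ R _ R' hR hQ hR'

omit [Fintype Δ] in
/-- The chain closes up after `orderOf s` steps: `∏_{i < ord s} α(cs^i·x, cs^{i+1}·x) = α(c·x, c·x) = 1`. Ours.
[cite: Lang1983AbelianVarieties, Ch. VIII §6, proof of Thm. 13 (pp. 224–227)] -/
private theorem prod_range_orderOf_eq_one (hN : aX.nabla.IsTransitive) (h : aX.IsCocycle) (s c : Δ) {T : SchemeOver k}
    (x : T ⟶ X) (xs : T ⟶ aX.nabla.N) (hxs : xs ≫ aX.nabla.incl = lift x (x ≫ (act s).hom)) :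
    ∏ i ∈ Finset.range (orderOf s), (xs ≫ aX.nabla.map aX.nabla (act (c * s ^ i)).hom) ≫ aX.α = 1 := by
  obtain ⟨R, hR, hprod⟩ := exists_chain act hN h s c x xs hxs (orderOf s)
  rw [pow_orderOf_eq_one, mul_one] at hR
  rw [hprod, Nabla.eq_comp_diag_of_incl _ R hR, Category.assoc, aX.diag_α, MonObj.comp_one]

/-- Reindexing a finite group along the left cosets of a cyclic subgroup: `(q, h) ↦ q.out · h` is a bijection
`(Δ ⧸ ⟨s⟩) × ⟨s⟩ → Δ` (Lagrange). Ours. [folklore] -/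
private theorem bijective_out_mul (H : Subgroup Δ) :
    Function.Bijective (fun p : (Δ ⧸ H) × H => p.1.out * (p.2 : Δ)) := by
  classical
  refine (Fintype.bijective_iff_injective_and_card _).2 ⟨?_, ?_⟩
  · rintro ⟨q, h⟩ ⟨q', h'⟩ hqq
    dsimp only at hqq
    have hq : q = q' := by
      rw [← QuotientGroup.out_eq' q, ← QuotientGroup.out_eq' q', QuotientGroup.eq]
      rw [show q.out⁻¹ * q'.out = (h : Δ) * (h' : Δ)⁻¹ by
        rw [eq_mul_inv_iff_mul_eq, mul_assoc, inv_mul_eq_iff_eq_mul]; exact hqq.symm]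
      exact H.mul_mem h.2 (H.inv_mem h'.2)
    subst hq
    have hh : (h : Δ) = h' := mul_left_cancel hqq
    rw [Subtype.ext hh]
  · rw [Fintype.card_prod, ← Nat.card_eq_fintype_card, ← Nat.card_eq_fintype_card, ← Nat.card_eq_fintype_card,
      ← Subgroup.card_eq_card_quotient_mul_card_subgroup]

/-- **Stabiliser sums vanish.**  Let `aX` be an Albanese datum of `X` whose `∇X` is transitive and whose `α_X` is a
cocycle, `act : Δ → Aut X` an action of a finite group, `s ∈ Δ`, and `(x, s·x)` a `T`-point of `∇X` (i.e. `s` preserves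
«the component of `x`»).  Then `∏_{γ ∈ Δ} α_X(γ·x, γs·x) = 1` in the group of `T`-points of `Alb_X`.  PROOF: split `Δ`
into left cosets `c⟨s⟩`; on each, the factors `α(cs^i·x, cs^{i+1}·x)`, `i < ord s`, telescope by the cocycle identity to
`α(c·x, c·x) = 1`.  This is the step that makes Lang's trace `h_*` independent of the chosen lift in the base-point-free
language of `∇`.  Ours. [cite: Lang1983AbelianVarieties, Ch. VIII §6, proof of Thm. 13 (pp. 224–227)]
[cite: Liu2021, §2.1 Def. 2.1 (1), Def. 2.3 (l. 1171–1208)] -/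
theorem IsCocycle.prod_map_comp_α_eq_one (hN : aX.nabla.IsTransitive) (h : aX.IsCocycle) (s : Δ) {T : SchemeOver k}
    (x : T ⟶ X) (xs : T ⟶ aX.nabla.N) (hxs : xs ≫ aX.nabla.incl = lift x (x ≫ (act s).hom)) :
    ∏ g, (xs ≫ aX.nabla.map aX.nabla (act g).hom) ≫ aX.α = 1 := by
  classical
  set H : Subgroup Δ := Subgroup.zpowers s
  set F : Δ → (T ⟶ aX.Alb.X) := fun g => (xs ≫ aX.nabla.map aX.nabla (act g).hom) ≫ aX.α
  have hs : IsOfFinOrder s := isOfFinOrder_of_finite s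
  -- reindex `Δ` by `(Δ ⧸ H) × H`
  rw [← Fintype.prod_bijective _ (bijective_out_mul H) (fun p => F (p.1.out * (p.2 : Δ))) F fun _ => rfl,
    Fintype.prod_prod_type]
  refine Finset.prod_eq_one fun q _ => ?_
  -- the inner product over `H = ⟨s⟩` is the chain product over `i < ord s`
  rw [← Fintype.prod_equiv (finEquivZPowers hs) (fun i => F (q.out * s ^ (i : ℕ))) _
      (fun i => by rw [finEquivZPowers_apply]), Fin.prod_univ_eq_prod_range (fun i => F (q.out * s ^ i)) (orderOf s)]
  exact prod_range_orderOf_eq_one act hN h s q.out x xs hxs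

/-- The underlying morphism of a finite sum of homomorphisms of abelian varieties is the pointwise product of the
underlying morphisms (Mumford §19). [folklore] -/
private theorem hom_hom_hom_sum {A B : AbelianVariety k} {κ : Type*} (s : Finset κ) (f : κ → (A ⟶ B)) :
    (∑ c ∈ s, f c).hom.hom.hom = ∏ c ∈ s, (f c).hom.hom.hom := by
  classical
  induction s using Finset.induction_on with
  | empty => rfl
  | insert c s hc ih => rw [Finset.sum_insert hc, Finset.prod_insert hc, ← ih]; rfl

/-- Precomposition distributes over a finite pointwise product of points of a group scheme. [folklore] -/
private theorem comp_finsetProd {T Z : SchemeOver k} {B : AbelianVariety k} {κ : Type*} (f : T ⟶ Z) (s : Finset κ)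
    (g : κ → (Z ⟶ B.X)) : f ≫ ∏ c ∈ s, g c = ∏ c ∈ s, f ≫ g c := by
  classical
  induction s using Finset.induction_on with
  | empty => rw [Finset.prod_empty, Finset.prod_empty, MonObj.comp_one]
  | insert c s hc ih => rw [Finset.prod_insert hc, Finset.prod_insert hc, MonObj.comp_mul, ih]

/-- **The `∇`-morphism `α_X ≫ Σ_g Alb_{act g}` of `AlbaneseTraceOfNablaDescent` kills every `T`-point `(x, s·x)` of
`∇X`** (`s ∈ Δ`): `(x, s·x) ≫ α_X ≫ Σ_g Alb_{act g} = ∏_g α_X(g·x, gs·x) = 1` — the `(T♭)`-shaped form of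
`prod_map_comp_α_eq_one` (with `α_X ≫ Alb_{act g} = ∇(act g) ≫ α_X`, Def. 2.3 l. 1207).  Consequently the morphism takes the
same value at `(a, b)` and `(a, s·b)` whenever both are points of `∇X` (cocycle at `(a, b, s·b)`): the well-definedness of
Lang's `h_*`.  Ours. [cite: Lang1983AbelianVarieties, Ch. VIII §6, proof of Thm. 13 (pp. 224–227)] [cite: Liu2021, §2.1 Def. 2.3 (l. 1202–1208)] -/
theorem IsCocycle.comp_α_comp_sum_map_eq_one (hN : aX.nabla.IsTransitive) (h : aX.IsCocycle) (s : Δ)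
    {T : SchemeOver k} (x : T ⟶ X) (xs : T ⟶ aX.nabla.N) (hxs : xs ≫ aX.nabla.incl = lift x (x ≫ (act s).hom)) :
    xs ≫ (aX.α ≫ (∑ g, aX.map aX (act g).hom).hom.hom.hom) = 1 := by
  rw [hom_hom_hom_sum, comp_finsetProd, comp_finsetProd, ← h.prod_map_comp_α_eq_one act hN s x xs hxs]
  refine Finset.prod_congr rfl fun g _ => ?_
  rw [aX.α_map aX (act g).hom, Category.assoc]

/-- **Well-definedness step**: for `T`-points `(a, b)` and `(a, s·b)` of `∇X` (`s ∈ Δ`), the `∇`-morphism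
`α_X ≫ Σ_g Alb_{act g}` takes the same value at both.  Ours. [cite: Lang1983AbelianVarieties, Ch. VIII §6, proof of Thm. 13 (pp. 224–227)] -/
theorem IsCocycle.comp_α_comp_sum_map_eq (hN : aX.nabla.IsTransitive) (h : aX.IsCocycle) (s : Δ)
    {T : SchemeOver k} (a b : T ⟶ X) (ab ab' : T ⟶ aX.nabla.N) (hab : ab ≫ aX.nabla.incl = lift a b)
    (hab' : ab' ≫ aX.nabla.incl = lift a (b ≫ (act s).hom)) :
    ab' ≫ (aX.α ≫ (∑ g, aX.map aX (act g).hom).hom.hom.hom) =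
      ab ≫ (aX.α ≫ (∑ g, aX.map aX (act g).hom).hom.hom.hom) := by
  -- `(b, s·b) ∈ ∇X` by symmetry + transitivity from `(a,b), (a, s·b)`; then the cocycle at `(a, b, s·b)`
  obtain ⟨ba, hba⟩ := aX.nabla.exists_swap a b ab hab
  obtain ⟨bb', hbb'⟩ := hN b a (b ≫ (act s).hom) ba ab' hba hab'
  have hφ : aX.nabla.IsCocycle (aX.α ≫ (∑ g, aX.map aX (act g).hom).hom.hom.hom) := h.comp_hom _
  rw [← hφ a b (b ≫ (act s).hom) ab bb' ab' hab hbb' hab',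
    h.comp_α_comp_sum_map_eq_one act hN s b bb' hbb', mul_one]

end Stabiliser

end Albanese

end Literature.NumberTheory.Automorphic.Liu2021.AppendixC

end
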